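import Literature.AlgebraicGeometry.Morphisms.FormalModuleIsogenyRoof
import Literature.AlgebraicGeometry.Modules.IdealMul
import HarnessLib

/-!
# The roof of the push–pull comparison: first leg with kernel and cokernel killed by an IDEAL SHEAF

The Stacks Project, Tag 088B / 088C (Cohomology of Schemes, Lemma 30.27.2 and the proper case of
Grothendieck's existence theorem); Görtz–Wedhorn, *Algebraic Geometry II* (2023), Construction
24.104 (3) and Lemma 24.105 (pp. 573–575). `Morphisms/FormalModuleIsogenyRoof(Torsion)` turn a roof
`𝓕 —u→ P ←v— 𝓗` of towers of `𝒪_X`-modules, BOTH legs `a`-power isogenies, into a morphism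
`α : 𝓕 → 𝓗` with `a`-power torsion kernel and cokernel — the situation of a Chow cover of a NORMAL
scheme. For a general proper scheme the first leg (the unit `𝓕_n → ρ_*ρ^*𝓕_n` of a Chow cover
`ρ` which is an isomorphism over a dense open `U`) has kernel and cokernel killed only by a power of
an ideal of definition `𝒥` of the exceptional locus `X ∖ U` (Görtz–Wedhorn Lemma 24.105), while the
second leg `(ρ_*𝒢')^ → ρ_*(𝒢'^)` stays an `a`-power isogeny (theorem on formal functions). This file
records that case:

* `exists_towerQuasiInverse_of_powTorsion` — a morphism of towers `v : 𝓗 → P` whose levelwise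
  kernels and cokernels are killed by `bᶜ` has a quasi-inverse `w : P → 𝓗`, `v ≫ w = b²ᶜ`,
  `w ≫ v = b²ᶜ` levelwise (tower form of `exists_quasiInverse_of_torsion_kernel_cokernel`);
* `exists_towerHom_of_roof` — hence `α := u ≫ w : 𝓕 → 𝓗` with, levelwise, `b²ᶜ·ker α_n ⊆ ker u_n`
  (`ker α_n —b²ᶜ→ 𝓕_n —u_n→ P_n` vanishes) and `b²ᶜ·𝓗_n ⊆ v(P_n) + im α_n`
  (`b²ᶜ ≫ coker.π α_n` factors through `v_n ≫ coker.π u_n`);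
* `isKilledBy_mul_kernel_of_comp_eq_zero`, `isKilledBy_mul_cokernel_of_fac` — module-level
  transfer: if `𝒥` kills `ker u` (resp. `𝒥'` kills `coker u`) then `(b)ᵈ·𝒥` kills `ker α`
  (resp. `(b)ᵈ·𝒥'` kills `coker α`);
* `exists_towerHom_of_roof_of_isKilledBy` — **the roof with first leg killed by ideal sheaves:
  `α : 𝓕 → 𝓗` with levelwise kernels killed by `(b)²ᶜ·𝒥` and cokernels killed by `(b)²ᶜ·𝒥'`.**

Everything is proved; no named facts; no definitions.

## References

* The Stacks Project, Tag 088B (Lemma 30.27.2), Tag 088C. [StacksProject]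
* U. Görtz, T. Wedhorn, *Algebraic Geometry II: Cohomology of Schemes*, Springer Spektrum (2023),
  doi:10.1007/978-3-658-43031-3: Construction 24.104 (3), Lemma 24.105 (pp. 573–575).
  [GortzWedhorn2023]
-/

noncomputable section

-- `TopCat.Presheaf`/`Scheme.Modules` are not reducible (as in Mathlib's `AlgebraicGeometry/Modules`).
set_option backward.isDefEq.respectTransparency false

open CategoryTheory CategoryTheory.Limits AlgebraicGeometry TopologicalSpace Opposite
open Literature.AlgebraicGeometry.Modules Literature.AlgebraicGeometry.Motives

universe u

namespace Literature.AlgebraicGeometry.Morphisms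

variable {X : Scheme.{u}} (b : Γ(X, ⊤))

/-! ### Module-level transfer of `IsKilledBy` along a roof -/

section Modules

/-- The ideal of the affine open `V` attached to `(b)ᵈ` is generated by `bᵈ|_V`. [folklore] -/
private theorem ideal_pow_ofIdealTop_span' (d : ℕ) (V : X.affineOpens) :
    (Scheme.IdealSheafData.ofIdealTop (Ideal.span {b}) ^ d).ideal V =
      Ideal.span {X.presheaf.map (homOfLE (le_top : (V : X.Opens) ≤ ⊤)).op (b ^ d)} := by
  rw [Scheme.IdealSheafData.ideal_pow, Pi.pow_apply, Scheme.IdealSheafData.ofIdealTop_ideal,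
    Ideal.map_span, Set.image_singleton, Ideal.span_singleton_pow, map_pow]

/-- **Kernel transfer.** Let `φ : F → A`, `u : F → B` with `ker φ —bᵈ→ F —u→ B` zero (i.e.
`bᵈ · ker φ ⊆ ker u`). If the ideal sheaf `𝒥` kills `ker u`, then `(b)ᵈ·𝒥` kills `ker φ`.
[cite: StacksProject, Tag 088B] -/
theorem isKilledBy_mul_kernel_of_comp_eq_zero {F A B : X.Modules} (φ : F ⟶ A) (u : F ⟶ B) {d : ℕ}
    (h : kernel.ι φ ≫ globalScalar F (b ^ d) ≫ u = 0) {J : X.IdealSheafData}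
    (hu : IsKilledBy J (kernel u)) :
    IsKilledBy (Scheme.IdealSheafData.ofIdealTop (Ideal.span {b}) ^ d * J) (kernel φ) := by
  intro V r hr k
  rw [Scheme.IdealSheafData.ideal_mul, Pi.mul_apply] at hr
  refine Submodule.mul_induction_on hr (fun m hm t ht => ?_) (fun x y hx hy => ?_)
  · rw [ideal_pow_ofIdealTop_span', Ideal.mem_span_singleton'] at hm
    obtain ⟨s, rfl⟩ := hm
    apply kernel_ι_app_injective φ (V : X.Opens)
    rw [Scheme.Modules.Hom.app_smul, map_zero]
    set x : Γ(F, V) := (kernel.ι φ).app (V : X.Opens) k with hx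
    -- `bᵈ • x` is killed by `u`, hence a section of `ker u`
    have hux : u.app (V : X.Opens)
        (X.presheaf.map (homOfLE (le_top : (V : X.Opens) ≤ ⊤)).op (b ^ d) • x) = 0 := by
      rw [← globalScalar_app_apply, hx, ← CategoryTheory.comp_apply, ← CategoryTheory.comp_apply,
        ← Scheme.Modules.Hom.comp_app, ← Scheme.Modules.Hom.comp_app, h,
        Scheme.Modules.Hom.zero_app]
      rfl
    obtain ⟨k', hk'⟩ := exists_kernel_ι_app_eq u (V : X.Opens) _ hux
    have ht0 : t • (X.presheaf.map (homOfLE (le_top : (V : X.Opens) ≤ ⊤)).op (b ^ d) • x) = 0 := by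
      rw [← hk', ← Scheme.Modules.Hom.app_smul, hu V t ht k', map_zero]
    rw [show s * X.presheaf.map (homOfLE (le_top : (V : X.Opens) ≤ ⊤)).op (b ^ d) * t =
        s * (t * X.presheaf.map (homOfLE (le_top : (V : X.Opens) ≤ ⊤)).op (b ^ d)) by ring,
      mul_smul, mul_smul, ht0, smul_zero]
  · rw [add_smul, hx, hy, add_zero]

/-- **Cokernel transfer.** Let `φ : F → A`, `v : A → B`, `u : F' → B` and
`q : coker u → coker φ` with `bᵈ ≫ coker.π φ = v ≫ coker.π u ≫ q` (i.e. `bᵈ·A ⊆ im φ + (im of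
sections coming through `coker u`)`). If the ideal sheaf `𝒥'` kills `coker u`, then `(b)ᵈ·𝒥'`
kills `coker φ` (epimorphisms are locally surjective). [cite: StacksProject, Tag 088B] -/
theorem isKilledBy_mul_cokernel_of_fac {F F' A B : X.Modules} (φ : F ⟶ A) (v : A ⟶ B) (u : F' ⟶ B)
    {d : ℕ} (q : cokernel u ⟶ cokernel φ)
    (h : globalScalar A (b ^ d) ≫ cokernel.π φ = v ≫ cokernel.π u ≫ q) {J' : X.IdealSheafData}
    (hu : IsKilledBy J' (cokernel u)) :
    IsKilledBy (Scheme.IdealSheafData.ofIdealTop (Ideal.span {b}) ^ d * J') (cokernel φ) := by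
  intro V r hr y
  rw [Scheme.IdealSheafData.ideal_mul, Pi.mul_apply] at hr
  refine Submodule.mul_induction_on hr (fun m hm t ht => ?_) (fun x y' hx hy => ?_)
  · rw [ideal_pow_ofIdealTop_span', Ideal.mem_span_singleton'] at hm
    obtain ⟨s, rfl⟩ := hm
    -- `t • bᵈ • y = 0`, checked locally where `y` lifts to `A`
    have ht0 : t • (globalScalar (cokernel φ) (b ^ d)).app (V : X.Opens) y = 0 := by
      refine section_eq_zero_of_locally (cokernel φ) _ fun x hx => ?_
      obtain ⟨W, hWV, hxW, a, ha⟩ := Scheme.Modules.exists_app_eq_of_epi (cokernel.π φ) V y x hx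
      obtain ⟨W', hW', hxW', hW'le⟩ := Opens.isBasis_iff_nbhd.mp X.isBasis_affineOpens hxW
      refine ⟨W', hW'le.trans hWV, hxW', ?_⟩
      have hle : (⟨W', hW'⟩ : X.affineOpens) ≤ V := hW'le.trans hWV
      -- restrict the lift to the affine `W'`
      have ha' : (cokernel.π φ).app W' (A.presheaf.map (homOfLE hW'le).op a) =
          (cokernel φ).presheaf.map (homOfLE (hW'le.trans hWV)).op y := by
        rw [Scheme.Modules.Hom.app_map_apply, ha, map_map]
        exact map_eq_map _ _ _ _
      rw [Scheme.Modules.map_smul, ← Scheme.Modules.Hom.app_map_apply, ← ha',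
        ← CategoryTheory.comp_apply, ← Scheme.Modules.Hom.comp_app, ← globalScalar_comp, h,
        Scheme.Modules.Hom.comp_app, Scheme.Modules.Hom.comp_app, CategoryTheory.comp_apply,
        CategoryTheory.comp_apply, ← Scheme.Modules.Hom.app_smul]
      exact (congrArg (q.app W') (hu ⟨W', hW'⟩ _ (J'.ideal_le_comap_ideal hle ht) _)).trans
        (map_zero _)
    rw [show s * X.presheaf.map (homOfLE (le_top : (V : X.Opens) ≤ ⊤)).op (b ^ d) * t =
        s * (t * X.presheaf.map (homOfLE (le_top : (V : X.Opens) ≤ ⊤)).op (b ^ d)) by ring,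
      mul_smul, mul_smul, ← globalScalar_app_apply, ht0, smul_zero]
  · rw [add_smul, hx, hy, add_zero]

end Modules

/-! ### Towers: quasi-inverse and roof -/

section Towers

/-- Multiplication by `b` on every level of a tower is a morphism of towers. [folklore] -/
private theorem globalScalar_naturality' (T : ℕᵒᵖ ⥤ X.Modules) {k k' : ℕᵒᵖ} (g : k ⟶ k') :
    T.map g ≫ globalScalar (T.obj k') b = globalScalar (T.obj k) b ≫ T.map g :=
  (globalScalar_comp (T.map g) b).symm

/-- **Tower quasi-inverse.** A morphism of towers `v : 𝓗 → P` of `𝒪_X`-modules whose levelwise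
kernels and cokernels are killed by `bᶜ` admits `w : P → 𝓗` with `v_n ≫ w_n = b²ᶜ` and
`w_n ≫ v_n = b²ᶜ` for all `n` (the tower form of `exists_quasiInverse_of_torsion_kernel_cokernel`,
in the abelian functor category with the central endomorphism "multiplication by `bᶜ`").
[cite: StacksProject, Tag 088B] [cite: GortzWedhorn2023, Construction 24.104 (3) (p. 573)] -/
theorem exists_towerQuasiInverse_of_powTorsion {P 𝓗 : ℕᵒᵖ ⥤ X.Modules} (v : 𝓗 ⟶ P) {c : ℕ}
    (hvk : ∀ n, kernel.ι (v.app n) ≫ globalScalar (𝓗.obj n) (b ^ c) = 0)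
    (hvc : ∀ n, globalScalar (P.obj n) (b ^ c) ≫ cokernel.π (v.app n) = 0) :
    ∃ w : P ⟶ 𝓗, (∀ n, v.app n ≫ w.app n = globalScalar (𝓗.obj n) (b ^ (c + c))) ∧
      ∀ n, w.app n ≫ v.app n = globalScalar (P.obj n) (b ^ (c + c)) := by
  let ε : ∀ T : ℕᵒᵖ ⥤ X.Modules, T ⟶ T := fun T =>
    { app := fun k => globalScalar (T.obj k) (b ^ c)
      naturality := fun _ _ g => globalScalar_naturality' _ T g }
  have hε : ∀ {T T' : ℕᵒᵖ ⥤ X.Modules} (f : T ⟶ T'), ε T ≫ f = f ≫ ε T' := fun f =>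
    NatTrans.ext (funext fun k => globalScalar_comp (f.app k) _)
  have hk' : ∀ {T : ℕᵒᵖ ⥤ X.Modules} (z : T ⟶ 𝓗), z ≫ v = 0 → z ≫ ε 𝓗 = 0 := by
    intro T z hz
    refine NatTrans.ext (funext fun k => ?_)
    have hzk : z.app k ≫ v.app k = 0 := by rw [← NatTrans.comp_app, hz, NatTrans.app_zero]
    rw [NatTrans.comp_app, NatTrans.app_zero]
    change z.app k ≫ globalScalar (𝓗.obj k) (b ^ c) = 0
    rw [← kernel.lift_ι (v.app k) (z.app k) hzk, Category.assoc, hvk k, comp_zero]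
  have hc' : ∀ {T : ℕᵒᵖ ⥤ X.Modules} (q : P ⟶ T), v ≫ q = 0 → ε P ≫ q = 0 := by
    intro T q hq
    refine NatTrans.ext (funext fun k => ?_)
    have hqk : v.app k ≫ q.app k = 0 := by rw [← NatTrans.comp_app, hq, NatTrans.app_zero]
    rw [NatTrans.comp_app, NatTrans.app_zero]
    change globalScalar (P.obj k) (b ^ c) ≫ q.app k = 0
    rw [← cokernel.π_desc (v.app k) (q.app k) hqk, reassoc_of% (hvc k), zero_comp]
  obtain ⟨w, hvw, hwv⟩ := exists_quasiInverse_of_torsion_kernel_cokernel ε hε v hk' hc'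
  refine ⟨w, fun k => ?_, fun k => ?_⟩
  · have h := congr_app hvw k
    rw [NatTrans.comp_app, NatTrans.comp_app] at h
    change v.app k ≫ w.app k = globalScalar (𝓗.obj k) (b ^ c) ≫ globalScalar (𝓗.obj k) (b ^ c) at h
    rw [h, pow_add, globalScalar_mul]
  · have h := congr_app hwv k
    rw [NatTrans.comp_app, NatTrans.comp_app] at h
    change w.app k ≫ v.app k = globalScalar (P.obj k) (b ^ c) ≫ globalScalar (P.obj k) (b ^ c) at h
    rw [h, pow_add, globalScalar_mul]

/-- **The roof** `𝓕 —u→ P ←v— 𝓗` with `v` an isogeny (levelwise kernels and cokernels killed by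
`bᶜ`): `α := u ≫ w`, `w` a quasi-inverse of `v`, satisfies levelwise
(1) `ker α_n —b²ᶜ→ 𝓕_n —u_n→ P_n = 0` and (2) `b²ᶜ ≫ coker.π α_n = v_n ≫ coker.π u_n ≫ q_n` for
some `q_n : coker u_n → coker α_n`. [cite: StacksProject, Tag 088B]
[cite: GortzWedhorn2023, Construction 24.104 (3) and Lemma 24.105 (pp. 573–575)] -/
theorem exists_towerHom_of_roof {𝓕 P 𝓗 : ℕᵒᵖ ⥤ X.Modules} (u : 𝓕 ⟶ P) (v : 𝓗 ⟶ P) {c : ℕ}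
    (hvk : ∀ n, kernel.ι (v.app n) ≫ globalScalar (𝓗.obj n) (b ^ c) = 0)
    (hvc : ∀ n, globalScalar (P.obj n) (b ^ c) ≫ cokernel.π (v.app n) = 0) :
    ∃ α : 𝓕 ⟶ 𝓗,
      (∀ n, kernel.ι (α.app n) ≫ globalScalar (𝓕.obj n) (b ^ (c + c)) ≫ u.app n = 0) ∧
      ∀ n, ∃ q : cokernel (u.app n) ⟶ cokernel (α.app n),
        globalScalar (𝓗.obj n) (b ^ (c + c)) ≫ cokernel.π (α.app n) =
          v.app n ≫ cokernel.π (u.app n) ≫ q := by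
  obtain ⟨w, hvw, hwv⟩ := exists_towerQuasiInverse_of_powTorsion b v hvk hvc
  refine ⟨u ≫ w, fun k => ?_, fun k => ?_⟩
  · rw [globalScalar_comp, ← hwv k, NatTrans.comp_app]
    rw [← Category.assoc (u.app k), kernel.condition_assoc, zero_comp]
  · have hαk : (u ≫ w).app k = u.app k ≫ w.app k := NatTrans.comp_app _ _ _
    refine ⟨cokernel.desc (u.app k) (w.app k ≫ cokernel.π ((u ≫ w).app k))
      (by rw [← Category.assoc, ← hαk]; exact cokernel.condition _), ?_⟩
    rw [cokernel.π_desc, ← Category.assoc, hvw k]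

/-- **The roof with first leg killed by ideal sheaves.** Let `u : 𝓕 → P` and `v : 𝓗 → P` be
morphisms of towers of `𝒪_X`-modules, `v` with levelwise kernels and cokernels killed by `bᶜ`, and
`u` with levelwise kernels killed by the ideal sheaf `𝒥` and cokernels killed by `𝒥'`. Then there is
`α : 𝓕 → 𝓗` whose levelwise kernels are killed by `(b)²ᶜ·𝒥` and cokernels by `(b)²ᶜ·𝒥'`. In the
proof of Grothendieck's existence theorem for a proper scheme: `u` = the unit of a Chow cover
(Görtz–Wedhorn Lemma 24.105), `v` = the comparison of the theorem on formal functions.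
[cite: StacksProject, Tag 088B] [cite: StacksProject, Tag 088C]
[cite: GortzWedhorn2023, Construction 24.104 (3) and Lemma 24.105 (pp. 573–575)] -/
theorem exists_towerHom_of_roof_of_isKilledBy {𝓕 P 𝓗 : ℕᵒᵖ ⥤ X.Modules} (u : 𝓕 ⟶ P) (v : 𝓗 ⟶ P)
    {c : ℕ} (hvk : ∀ n, kernel.ι (v.app n) ≫ globalScalar (𝓗.obj n) (b ^ c) = 0)
    (hvc : ∀ n, globalScalar (P.obj n) (b ^ c) ≫ cokernel.π (v.app n) = 0)
    {J J' : X.IdealSheafData} (huk : ∀ n, IsKilledBy J (kernel (u.app n)))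
    (huc : ∀ n, IsKilledBy J' (cokernel (u.app n))) :
    ∃ α : 𝓕 ⟶ 𝓗,
      (∀ n, IsKilledBy (Scheme.IdealSheafData.ofIdealTop (Ideal.span {b}) ^ (c + c) * J)
        (kernel (α.app n))) ∧
      ∀ n, IsKilledBy (Scheme.IdealSheafData.ofIdealTop (Ideal.span {b}) ^ (c + c) * J')
        (cokernel (α.app n)) := by
  obtain ⟨α, hk, hc⟩ := exists_towerHom_of_roof b u v hvk hvc
  refine ⟨α, fun n => isKilledBy_mul_kernel_of_comp_eq_zero b (α.app n) (u.app n) (hk n) (huk n),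
    fun n => ?_⟩
  obtain ⟨q, hq⟩ := hc n
  exact isKilledBy_mul_cokernel_of_fac b (α.app n) (v.app n) (u.app n) q hq (huc n)

end Towers

end Literature.AlgebraicGeometry.Morphisms

end
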